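import Literature.Computability.Complexity.TimeBounds
import Literature.Computability.Complexity.BoolEncodings
import Literature.Computability.Complexity.Classes
import HarnessLib

-- provenance: harness21/H21/H21/Prelude/CplxCore/Nondeterministic.lean @ 2e50299 (interim HEAD d8f2665); M5 mechanical rewrite
/-!
# Complexity core: witness operators and nondeterministic classes

Trunk `CplxCore`, concept C4 (`Nondeterministic`): nondeterminism at the level of classes of
languages `Set (Language Bool)` (outline D3), via *witness operators* using the fixed Bool
pairing `boolPair`:

* `polyExists C` — languages `{x | ∃ y, |y| ≤ p |x| ∧ ⟨x, y⟩ ∈ L'}` for some `L' ∈ C` and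
  polynomial `p`; `polyForall C := co (polyExists (co C))`;
* `NP := polyExists P`, `coNP := co NP`, `UP` (unique witnesses), `coUP`;
* `IsPolyVerifierFor R p L` — `R` is a verifier relation (as a language of pairs) for `L`
  with witness-length bound `p`;
* `NTIME t` (verifier form with an explicit `c * t n + c` bound, see below), `coNTIME`,
  `NE`, `NEXP`.

Mathlib has no complexity classes (searched `NP`, `NTIME`, nondeterministic Turing machines:
nothing beyond the deterministic bundled machines `Turing.TM2ComputableAux`,
`Turing.TM2OutputsInTime` in `Mathlib/Computability/TuringMachine/Computable.lean`, wrapped in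
`Literature.Prelude.CplxCore.TimeBounds`). We reuse `Computability.encodeBool`, `Polynomial.eval`,
`Set.Subsingleton`.

## Design notes

* Nondeterminism is modelled by *certificates* (Arora–Barak Def. 2.1), not by nondeterministic
  transition functions: no surgery on Mathlib's TM2 model is needed, and `NP = polyExists P`
  is the textbook verifier definition.
* `NTIME t` (review F1). A language is in `NTIME t` if there are a constant `c`, a Boolean
  relation `R x y` and a TM2 machine `M` computing `R` on the pair `boolPair x y` within
  `c * t |x| + c` steps *for every witness `y` inside the length bound `|y| ≤ c * t |x| + c`*,
  such that `x ∈ L ↔ ∃ y, |y| ≤ c * t |x| + c ∧ R x y`. The time bound is imposed ONLY on pairs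
  whose witness is inside the length bound: by the halting rule (outline D1) a TM2 machine must
  pop its whole input `boolPair x y` before reaching the halting configuration, so a bound in
  `|x|` alone imposed on *all* pairs `(x, y)` would be unsatisfiable and make `NTIME t` empty.
  The bound is the explicit arithmetic `c * t n + c` (outline D2), avoiding an implicit
  non-computable big-O constant. For `t n ≥ n` this class coincides with the usual NTIME
  defined by nondeterministic multitape machines up to the standard polynomial-slack-free
  simulation (guess the certificate, then verify).
* `UP` requires the witness set to be `Set.Subsingleton` for *every* input (Valiant 1976).
* No `MA` (outline D3: promise-style classes are not operator classes).
* Universe convention (outline D7): everything lives over `List Bool`; no universe variables.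

## References

* S. Arora, B. Barak, *Computational Complexity: A Modern Approach*, CUP 2009, Def. 2.1 (NP via
  certificates), Def. 1.11/§2.1.2 (NTIME, NDTMs), Def. 2.19–2.20 (coNP), §2.6.2 (NEXP),
  Thm. 2.6/Claim 2.4 (P ⊆ NP ⊆ EXP), Def. 5.3 and Remark 5.8 (Σₚ/Πₚ via ∃/∀ operators),
  Def. 9.14 / Ex. 9 (UP).
* M. Sipser, *Introduction to the Theory of Computation*, 3rd ed., Def. 7.18–7.19 (verifier, NP),
  Def. 7.21 (NTIME), Thm. 7.20.
* L. Valiant, *Relative complexity of checking and evaluating*, Inf. Proc. Lett. 5 (1976) (UP).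
* C. Papadimitriou, *Computational Complexity*, Addison-Wesley 1994, §20.1 (NEXP, NE).
-/

namespace Literature.Computability.Complexity

open _root_.Computability Turing

/-! ### Witness operators -/

/-- The polynomially-bounded existential (certificate) operator on classes:
`L ∈ polyExists C` iff there are `L' ∈ C` and a polynomial `p` with
`x ∈ L ↔ ∃ y, |y| ≤ p |x| ∧ boolPair x y ∈ L'`. Thus `NP = polyExists P` and
`Σₖ₊₁ = polyExists Πₖ`. [Arora–Barak 2009, Def. 2.1 and Def. 5.3/Remark 5.8] [cite: AroraBarak2009, Def. 2.1 and Def. 5.3/Remark 5.8] -/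
def polyExists (C : Set (Language Bool)) : Set (Language Bool) :=
  {L | ∃ L' ∈ C, ∃ p : Polynomial ℕ, ∀ x : List Bool,
    x ∈ L ↔ ∃ y : List Bool, y.length ≤ p.eval x.length ∧ boolPair x y ∈ L'}

/-- `polyExists` is monotone in the class. [Arora–Barak 2009, Def. 5.3] [cite: AroraBarak2009, Def. 5.3] -/
theorem polyExists_mono {C D : Set (Language Bool)} (h : C ⊆ D) :
    polyExists C ⊆ polyExists D := by
  rintro L ⟨L', hL', p, hp⟩
  exact ⟨L', h hL', p, hp⟩

/-- The polynomially-bounded universal operator on classes,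
`polyForall C := co (polyExists (co C))`:
`L ∈ polyForall C` iff there are `L' ∈ C` and a polynomial `p` with
`x ∈ L ↔ ∀ y, |y| ≤ p |x| → boolPair x y ∈ L'` (see `mem_polyForall_iff`). Thus
`coNP = polyForall P` and `Πₖ₊₁ = polyForall Σₖ`. [Arora–Barak 2009, Def. 2.20, Def. 5.3] [cite: AroraBarak2009, Def. 2.20  Def. 5.3] -/
def polyForall (C : Set (Language Bool)) : Set (Language Bool) :=
  co (polyExists (co C))

/-- Unfolding `polyForall`: `L ∈ polyForall C ↔ ∃ L' ∈ C, ∃ p, ∀ x, x ∈ L ↔ ∀ y,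
|y| ≤ p |x| → boolPair x y ∈ L'`. [Arora–Barak 2009, Def. 2.20 (coNP, "for all" form)] [cite: AroraBarak2009, Def. 2.20 (coNP  "for all" form] -/
theorem mem_polyForall_iff {C : Set (Language Bool)} {L : Language Bool} :
    L ∈ polyForall C ↔ ∃ L' ∈ C, ∃ p : Polynomial ℕ, ∀ x : List Bool,
      x ∈ L ↔ ∀ y : List Bool, y.length ≤ p.eval x.length → boolPair x y ∈ L' := by
  have hc : ∀ (K : Language Bool) (x : List Bool), x ∈ Kᶜ ↔ x ∉ K := fun _ _ => Iff.rfl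
  simp only [polyForall, co, polyExists, Set.mem_setOf_eq]
  constructor
  · rintro ⟨L', hL', p, hp⟩
    refine ⟨L'ᶜ, hL', p, fun x => ?_⟩
    have := hp x
    simp only [hc] at this ⊢
    rw [← not_iff_not, this]
    push Not
    rfl
  · rintro ⟨L', hL', p, hp⟩
    refine ⟨L'ᶜ, by simpa [Language.compl_compl] using hL', p, fun x => ?_⟩
    have := hp x
    simp only [hc]
    rw [this]
    push Not
    rfl

/-! ### NP, coNP, UP -/

/-- The class `NP = polyExists P`: languages with polynomially bounded, polynomial-time
verifiable certificates. [Arora–Barak 2009, Def. 2.1; Sipser, Def. 7.19] [cite: AroraBarak2009, Def. 2.1] -/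
noncomputable def Nondeterministic.NP : Set (Language Bool) :=
  polyExists Classes.P

/-- The class `coNP = co NP = {L | Lᶜ ∈ NP}`. [Arora–Barak 2009, Def. 2.19; Sipser, §7.4] [cite: AroraBarak2009, Def. 2.19] -/
noncomputable def coNP : Set (Language Bool) :=
  co Nondeterministic.NP

/-- The class `UP` (unambiguous polynomial time): as `NP`, but for every input `x` the set of
accepted witnesses `{y | |y| ≤ p |x| ∧ boolPair x y ∈ L'}` has at most one element
(`Set.Subsingleton`). [Valiant 1976; Arora–Barak 2009, Def. 9.14] [cite: Valiant1976] -/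
noncomputable def UP : Set (Language Bool) :=
  {L | ∃ L' ∈ Classes.P, ∃ p : Polynomial ℕ,
    (∀ x : List Bool, x ∈ L ↔ ∃ y : List Bool, y.length ≤ p.eval x.length ∧ boolPair x y ∈ L') ∧
    ∀ x : List Bool, {y : List Bool | y.length ≤ p.eval x.length ∧ boolPair x y ∈ L'}.Subsingleton}

/-- The class `coUP = co UP`. [Valiant 1976; Arora–Barak 2009, Def. 9.14] [cite: Valiant1976] -/
noncomputable def coUP : Set (Language Bool) :=
  co UP

/-- `IsPolyVerifierFor R p L`: the language of pairs `R` (via `boolPair`) is a verifier relation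
for `L` with witness-length bound `p`, i.e. `x ∈ L ↔ ∃ y, |y| ≤ p |x| ∧ boolPair x y ∈ R`.
No complexity requirement on `R` is included (so `L ∈ NP ↔ ∃ R ∈ P, ∃ p, IsPolyVerifierFor R p L`,
`mem_NP_iff_verifier`). [Sipser, Def. 7.18 (verifier); Arora–Barak 2009, Def. 2.1] [cite: AroraBarak2009, Def. 2.1] -/
def IsPolyVerifierFor (R : Language Bool) (p : Polynomial ℕ) (L : Language Bool) : Prop :=
  ∀ x : List Bool, x ∈ L ↔ ∃ y : List Bool, y.length ≤ p.eval x.length ∧ boolPair x y ∈ R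

/-- `NP` is the class of languages with a polynomial-time verifier:
`L ∈ NP ↔ ∃ R ∈ P, ∃ p, IsPolyVerifierFor R p L` (definitional unfolding).
[Sipser, Def. 7.19; Arora–Barak 2009, Def. 2.1] [cite: AroraBarak2009, Def. 2.1] -/
theorem mem_NP_iff_verifier {L : Language Bool} :
    L ∈ Nondeterministic.NP ↔ ∃ R ∈ Classes.P, ∃ p : Polynomial ℕ, IsPolyVerifierFor R p L :=
  Iff.rfl

/-! ### Nondeterministic time classes -/

/-- `NTIME t`: languages decidable in nondeterministic time `O(t n)`, in verifier form.
`L ∈ NTIME t` iff there are `c : ℕ`, a Boolean relation `R` and a TM2 machine `M` such that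
(i) for all `x` and all witnesses `y` with `|y| ≤ c * t |x| + c`, `M` on input `boolPair x y`
outputs `encodeBool (R x y)` within `c * t |x| + c` steps, and
(ii) `x ∈ L ↔ ∃ y, |y| ≤ c * t |x| + c ∧ R x y = true`.
The running-time requirement is imposed only on pairs whose witness is inside the length
bound: a TM2 machine must consume its whole input before halting (outline D1), so requiring the
bound `c * t |x| + c` on all pairs `(x, y)` would make the class empty. The bound is the
explicit arithmetic big-O form `c * t n + c` (outline D2). For `t n ≥ n` this agrees with the
NDTM definition (guess-and-verify). [Arora–Barak 2009, Def. 2.1 and §2.1.2 (NTIME, Thm. 2.6);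
Sipser, Def. 7.21 and Thm. 7.20] [cite: AroraBarak2009, Def. 2.1 and §2.1.2 (NTIME  Thm. 2.6] -/
def NTIME (t : ℕ → ℕ) : Set (Language Bool) :=
  {L | ∃ (c : ℕ) (R : List Bool → List Bool → Bool) (M : TM2ComputableAux Bool Bool),
    (∀ x y : List Bool, y.length ≤ c * t x.length + c →
      M.OutputsWithin (boolPair x y) (encodeBool (R x y)) (c * t x.length + c)) ∧
    ∀ x : List Bool, x ∈ L ↔ ∃ y : List Bool, y.length ≤ c * t x.length + c ∧ R x y = true}

/-- `coNTIME t = co (NTIME t)`. [Arora–Barak 2009, Def. 2.19–2.20, §3.2] [cite: AroraBarak2009, Def. 2.19–2.20  §3.2] -/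
def coNTIME (t : ℕ → ℕ) : Set (Language Bool) :=
  co (NTIME t)

/-- The class `NE = ⋃_c NTIME(2^{c n})` of languages decidable in nondeterministic
linear-exponential time. [Papadimitriou 1994, §20.1; Arora–Barak 2009, §2.6.2] [cite: Papadimitriou1994, §20.1] -/
def NE : Set (Language Bool) :=
  ⋃ c : ℕ, NTIME (fun n => 2 ^ (c * n))

/-- The class `NEXP = ⋃ₖ NTIME(2^{nᵏ})` of languages decidable in nondeterministic exponential
time. [Arora–Barak 2009, Def. 2.18 / §2.6.2; Papadimitriou 1994, §20.1] [cite: AroraBarak2009, Def. 2.18 / §2.6.2] -/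
def NEXP : Set (Language Bool) :=
  ⋃ k : ℕ, NTIME (fun n => 2 ^ (n ^ k))

/-! ### API -/

/-- Monotonicity of `NTIME` in the time bound, for time-constructible `t`. (Not a mere
reindexing: the admissible witness range grows with the bound, so the verifier must be modified
to reject the newly in-range witnesses, i.e. to compute `|y| ≤ c * t |x| + c ∧ R x y` in time
`O(t' |x|)`, which needs `t` to be time constructible; without this hypothesis the inclusion
can fail for pathological `t`.) [Arora–Barak 2009, §2.1.2 and §3.1] [cite: AroraBarak2009, §2.1.2 and §3.1] -/
def NTIME_mono : Prop :=
  ∀ {t t' : ℕ → ℕ} (ht : IsTimeConstructible t) (h : ∀ n, t n ≤ t' n),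
    NTIME t ⊆ NTIME t'

/-- `P ⊆ NP` (ignore the certificate: `L' = {boolPair x y | x ∈ L}` is in `P` when `L` is, using
`polyTimeComputable_fst`). [Arora–Barak 2009, Claim 2.4; Sipser, §7.3] [cite: AroraBarak2009, Claim 2.4] -/
def P_subset_NP : Prop :=
  Classes.P ⊆ Nondeterministic.NP

/-- `UP ⊆ NP` (forget uniqueness). [Valiant 1976; Arora–Barak 2009, Def. 9.14] [cite: Valiant1976] -/
theorem UP_subset_NP : UP ⊆ Nondeterministic.NP := by
  rintro L ⟨L', hL', p, hp, -⟩
  exact ⟨L', hL', p, hp⟩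

/-- `NP ⊆ EXP` (enumerate all certificates of length `≤ p |x|`).
[Arora–Barak 2009, Claim 2.4] [cite: AroraBarak2009, Claim 2.4] -/
def NP_subset_EXP : Prop :=
  Nondeterministic.NP ⊆ EXP

/-- `NP = ⋃ₖ NTIME(nᵏ)`: the certificate definition agrees with the nondeterministic-time
definition. (True for the verifier-form `NTIME` above: given `L' ∈ P` deciding pairs in time
`q`, take `c` with `c * n ^ k + c ≥ max (p n) (q (2 n + 2 + p n))`; conversely restrict `R` to
in-range witnesses.) [Arora–Barak 2009, Thm. 2.6; Sipser, Thm. 7.20] [cite: AroraBarak2009, Thm. 2.6] -/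
def NP_eq_iUnion_NTIME : Prop :=
  Nondeterministic.NP = ⋃ k : ℕ, NTIME (fun n => n ^ k)

end Literature.Computability.Complexity
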